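import Summits.BirchSwinnertonDyer.BirchSwinnertonDyer.Theorems.ClassRecordThreeCornerAtThreeKolyImageOrderAtPrimeShift
import Summits.BirchSwinnertonDyer.BirchSwinnertonDyer.Theorems.ClassRecordThreeShimuraKolyvaginOrderBoundAtThreeSurjOrderShiftEntry
import Summits.BirchSwinnertonDyer.BirchSwinnertonDyer.Theorems.ClassRecordThreeCornerAtThreeKolyImageUnitEndShift
import Summits.BirchSwinnertonDyer.BirchSwinnertonDyer.Theorems.ClassRecordThreeShimuraKolyvaginOrderBoundAtThreeSurjOrderShiftEnd
import Summits.BirchSwinnertonDyer.BirchSwinnertonDyer.Theorems.ErratumRoadFiveShimuraKolyvaginOrderBoundInertS2OfCarrier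
import HarnessLib
/-!
# The IMAGE-KEYED Kolyvagin ORDER machine, I13 (ENTRY): the bound at ONE odd prime from Heegner-type POINTS `hpoints` at
# Kolyvagin primes of depth `M + k`, Kolyvagin reciprocity `hRT` and the Cassels–Tate inputs — for ANY Euler system at the
# conductor level — from the four image inputs instead of `ρ̄_{E,p}` onto
# (crux `CornerAtThree`, item stmt-BirchSwinnertonDyer-19111, conjunct 3 along the CARRIER-INERT Shimura road;
# cell `bsd-stepL`, seat `bsd-stepL-corner3-p2` g5 = WIDTH-LEVER lane B; `--supports … --as helper`)

HONEST FRAMING: THEOREMS ONLY (no definition, no named fact, no `sorry`); nothing here is a BSD class theorem;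
no census label moves (T7); item 19111 is NOT closed; every statement is CONDITIONAL on its displayed binders
exactly as its `hρ`-keyed original. BSD is not proved by any of this.

## The series (why this file exists)

Lane B's typed object `Theorems.CornerAtThreeShimuraInertDisplay` (conjunct 1 of the registered stub
`stub_upper3_inertDisplay` of `Cruxes/CornerAtThree/Lines/inert.lean`, planner RULING 35) is Kolyvagin's UNSHARP
order bound `#Ш(E/K)[3^∞] ≤ 3^(2·ord₃[E(K):ℤP])` for the CM point of `X_{N⁺,N⁻}` with `3 ∣ N⁻` on the (T4″)₃
corner (`E[3]` irreducible, `ρ̄_{E,3}` NOT onto). The tree's Shimura–Kolyvagin ORDER chain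
(`ErratumRoadFiveShimuraKolyvaginOrderBoundInert*`, `ClassRecordThreeShimuraKolyvaginOrderBoundAtThreeSurjOrderShift*`;
seats shim-p1 ∕ shim3a) is keyed on `hρ : ρ̄_{E,p}` ONTO, read ONLY through four consequences (seat shim3b g4 ∕ g5,
memo `shim/SHIM3B-G5-NOTE-19616.md` §2 «execute only if a consumer appears» — the consumer is lane B's inert line):
(hIz) some `z ∈ Γ_K` acts as `−1` on `E(K̄)[p]`, (hIs) `E(K̄)[p]` is a simple `Γ_K`-module, (hIc) its
`Γ_K`-commutant is scalar, (hIt) `E(K)[p] = 0`. The series `ClassRecordThreeCornerAtThreeKolyImage*.lean`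
(namespace `…Theorems.ShimuraKolyvaginOfImage`; theorem names = originals + `_ofImage`) re-keys the chain on these
four binders: statements and proofs are the originals VERBATIM with `hρ` replaced by `(hIz) (hIs) (hIc) (hIt)` and
the image-reading leaves replaced by shim3b's landed twins (`ShimuraKolyvaginCebotarevOfImage.McCallum1991_cor_3_2_pow_of_image`,
`ShimuraKolyvaginCebotarevKernelOfImage.exists_kolyvaginPrime_gt_pow_kernel_of_image`,
`ShimuraKolyvaginFixedOfTorsion.{geomTorsion_pow_eq_zero_of_fixed, torsionH1OfDvd_pow_injective}_of_torsionBy_eq_bot`,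
`KolyvaginDescent.*_of_torsionBy_eq_bot`). At `p = 3` the four inputs hold for EVERY irreducible `E[3]`
(`ShimuraKolyvaginOfImage.kolyvaginImageInputs_three_of_mem_inertSet`, p563651), so the re-keyed END serves the
corner; at `p ∈ {5, 7}` they hold on the non-surjective corners given `−1 ∈ ρ̄(Γ_ℚ)` (shim3b
`McCallum1991_cor_3_2_pow_of_irr_of_neg`). No new mathematics is claimed in the re-keyed files.

## THIS FILE re-keys shim3a g2's `…AtThreeSurjOrderShiftEntry` (p488647): `card_sha_primary_le_at_of_pointsM_of_reciprocityFinset_of_localDuality_shift_ofImage`.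
Statements ∕ proofs VERBATIM the originals except `hρ` ↦ `(hIz) (hIs) (hIc) (hIt)`, the image-reading leaves ↦
shim3b's `_of_image` ∕ `_of_torsionBy_eq_bot` twins (and I1 `KolyvaginDescent.*_of_torsionBy_eq_bot`), and calls into
earlier `_ofImage` twins of this series.
[cite: McCallumLMS1991, §1 Theorem (Kolyvagin), §3 Prop. 3.1, Cor. 3.2, §4 Lemma 4.3, Prop. 4.4, Lemma 4.6, Prop. 4.7, §5 Lemmas 5.1, 5.3, Thm. 5.4, Cor. 5.6]
[cite: GrossLMS1991, §2 Thm. 2.2 (2), Props. 5.3, 5.4, 8.2, §9, §10] [cite: Howard2004Duke, Thm. 3.2.2 (proof)] [cite: MilneADT2006, Ch. I Thm. 4.10(b), §6 Prop. 6.9, Thm. 6.13(a), Lemma 6.17]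
presearch: as I2 (cell D8 audit; shim3b g5 §1: nothing in print at an inert p = 3 for non-surjective image).

## (second part, merged to shorten the gate chain) the END of the machine (shim3a `…AtThreeSurjOrderShiftEnd` first theorem, re-keyed):

# The IMAGE-KEYED Kolyvagin ORDER machine, I14 (END of the machine): Kolyvagin's ORDER bound `#Ш(E/K)[p^∞] ≤ p^{2M₀}` for
# `p^{M₀}x₀ = P ∉ p^{M₀+1}E(K)`, `M₀ ≥ 1`, from the depth-`k` ring-class-rational carrier, Poitou–Tate and the Cassels–Tate
# inputs via the level shift (NO Tamagawa ∕ Kodaira–Néron clause), from the four image inputs instead of `ρ̄_{E,p}` onto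
# (crux `CornerAtThree`, item stmt-BirchSwinnertonDyer-19111, conjunct 3 along the CARRIER-INERT Shimura road;
# cell `bsd-stepL`, seat `bsd-stepL-corner3-p2` g5 = WIDTH-LEVER lane B; `--supports … --as helper`)

HONEST FRAMING: THEOREMS ONLY (no definition, no named fact, no `sorry`); nothing here is a BSD class theorem;
no census label moves (T7); item 19111 is NOT closed; every statement is CONDITIONAL on its displayed binders
exactly as its `hρ`-keyed original. BSD is not proved by any of this.

## The series (why this file exists)

Lane B's typed object `Theorems.CornerAtThreeShimuraInertDisplay` (conjunct 1 of the registered stub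
`stub_upper3_inertDisplay` of `Cruxes/CornerAtThree/Lines/inert.lean`, planner RULING 35) is Kolyvagin's UNSHARP
order bound `#Ш(E/K)[3^∞] ≤ 3^(2·ord₃[E(K):ℤP])` for the CM point of `X_{N⁺,N⁻}` with `3 ∣ N⁻` on the (T4″)₃
corner (`E[3]` irreducible, `ρ̄_{E,3}` NOT onto). The tree's Shimura–Kolyvagin ORDER chain
(`ErratumRoadFiveShimuraKolyvaginOrderBoundInert*`, `ClassRecordThreeShimuraKolyvaginOrderBoundAtThreeSurjOrderShift*`;
seats shim-p1 ∕ shim3a) is keyed on `hρ : ρ̄_{E,p}` ONTO, read ONLY through four consequences (seat shim3b g4 ∕ g5,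
memo `shim/SHIM3B-G5-NOTE-19616.md` §2 «execute only if a consumer appears» — the consumer is lane B's inert line):
(hIz) some `z ∈ Γ_K` acts as `−1` on `E(K̄)[p]`, (hIs) `E(K̄)[p]` is a simple `Γ_K`-module, (hIc) its
`Γ_K`-commutant is scalar, (hIt) `E(K)[p] = 0`. The series `ClassRecordThreeCornerAtThreeKolyImage*.lean`
(namespace `…Theorems.ShimuraKolyvaginOfImage`; theorem names = originals + `_ofImage`) re-keys the chain on these
four binders: statements and proofs are the originals VERBATIM with `hρ` replaced by `(hIz) (hIs) (hIc) (hIt)` and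
the image-reading leaves replaced by shim3b's landed twins (`ShimuraKolyvaginCebotarevOfImage.McCallum1991_cor_3_2_pow_of_image`,
`ShimuraKolyvaginCebotarevKernelOfImage.exists_kolyvaginPrime_gt_pow_kernel_of_image`,
`ShimuraKolyvaginFixedOfTorsion.{geomTorsion_pow_eq_zero_of_fixed, torsionH1OfDvd_pow_injective}_of_torsionBy_eq_bot`,
`KolyvaginDescent.*_of_torsionBy_eq_bot`). At `p = 3` the four inputs hold for EVERY irreducible `E[3]`
(`ShimuraKolyvaginOfImage.kolyvaginImageInputs_three_of_mem_inertSet`, p563651), so the re-keyed END serves the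
corner; at `p ∈ {5, 7}` they hold on the non-surjective corners given `−1 ∈ ρ̄(Γ_ℚ)` (shim3b
`McCallum1991_cor_3_2_pow_of_irr_of_neg`). No new mathematics is claimed in the re-keyed files.

## THIS FILE re-keys shim3a g2's `…AtThreeSurjOrderShiftEnd` (p489089) FIRST theorem only: `card_sha_primary_le_of_ringClassRationalPointsM_shift_of_poitouTate_of_localDuality_ofImage`
(`p`-generic; the `p = 3`-split unit-index twin of that file is not needed on the inert road and is not copied).
Statements ∕ proofs VERBATIM the originals except `hρ` ↦ `(hIz) (hIs) (hIc) (hIt)`, the image-reading leaves ↦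
shim3b's `_of_image` ∕ `_of_torsionBy_eq_bot` twins (and I1 `KolyvaginDescent.*_of_torsionBy_eq_bot`), and calls into
earlier `_ofImage` twins of this series.
[cite: McCallumLMS1991, §1 Theorem (Kolyvagin), §3 Prop. 3.1, Cor. 3.2, §4 Lemma 4.3, Prop. 4.4, Lemma 4.6, Prop. 4.7, §5 Lemmas 5.1, 5.3, Thm. 5.4, Cor. 5.6]
[cite: GrossLMS1991, §2 Thm. 2.2 (2), Props. 5.3, 5.4, 8.2, §9, §10] [cite: Howard2004Duke, Thm. 3.2.2 (proof)] [cite: MilneADT2006, Ch. I Thm. 4.10(b), §6 Prop. 6.9, Thm. 6.13(a), Lemma 6.17]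
presearch: as I2 (cell D8 audit; shim3b g5 §1: nothing in print at an inert p = 3 for non-surjective image).
-/

noncomputable section

open scoped Classical Pointwise
set_option linter.dupNamespace false

universe u

namespace Summit.BirchSwinnertonDyer.BirchSwinnertonDyer.Theorems.ShimuraKolyvaginOfImage

open Summit.BirchSwinnertonDyer.BirchSwinnertonDyer.Theorems.ShimuraKolyvaginOrder
open WeierstrassCurve NumberField IsDedekindDomain Field Function
open Literature.NumberTheory.EllipticCurves Literature.NumberTheory.EllipticCurves.KolyvaginDescent
open Literature.NumberTheory.GaloisRepresentations
open Literature.NumberTheory.GaloisCohomology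
open Literature.NumberTheory.GaloisRepresentations.DiscreteGaloisModule (mu MuCarrier)
open Summit.BirchSwinnertonDyer.Rank1Residual.X11b
open Summit.BirchSwinnertonDyer.BirchSwinnertonDyer.Theorems
open Summit.BirchSwinnertonDyer.BirchSwinnertonDyer.Theorems.ShimuraKolyvaginLocalShift (frobEqFrobInfty_pow_of_le)

-- Cup products need `LocallyCompactSpace Γ_K`; as in the tree's Cassels–Tate files.
attribute [local instance] absoluteGaloisGroup_compactSpace

-- `CharZero` of the completions (the Cassels–Tate local terms), as in the tree's files.
attribute [local instance] charZero_placeCompletion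

variable (W : WeierstrassCurve ℚ) {K : Type} [Field K] [NumberField K]

/-- **Kolyvagin's bound on `Ш(E/K)[p^∞]` at one odd prime `p` with the four image inputs (hIz) (hIs) (hIc) (hIt) in place of `ρ̄_{E,p}` onto, order form, from
Heegner-type points and Kolyvagin reciprocity (pairing form) at `p` and the Cassels–Tate inputs at level `p^{M₀}`,
conductor-keyed, `hpoints` at depth `M + k`** — twin of x11b3's `KolyvaginOrder.card_sha_primary_le_at_of_pointsM_of_reciprocityFinset_of_localDuality`
(McCallum 1991 §1 Theorem (Kolyvagin) ∕ Cor. 5.6; Gross 1991 Thm. 2.2 (2); module docstring), the Heegner-point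
binder replaced by `hN : W.conductorNorm ℤ = N₀`. [cite: McCallumLMS1991, §1 Theorem (Kolyvagin), Lemma 5.1, §2 Prop. 2.2,
Thm. 5.4, Cor. 5.6] [cite: GrossLMS1991, §2 Thm. 2.2 (2), §§3–8, §10] [cite: MilneADT2006, Ch. I §6, Prop. 6.9, Thm. 6.13(a)] -/
theorem card_sha_primary_le_at_of_pointsM_of_reciprocityFinset_of_localDuality_shift_ofImage
    [W.IsElliptic] (hK : IsImaginaryQuadratic K) {N₀ : ℕ} [NeZero N₀] (hN : W.conductorNorm ℤ = N₀) (k : ℕ)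
    {P : (W.baseChange K).toAffine.Point} (hnt : ¬ IsOfFinAddOrder P) {p : ℕ} (hp : p.Prime) (hp2 : p ≠ 2)
    (hIz : ∃ z : Field.absoluteGaloisGroup K, ∀ t : geomTorsion (W.baseChange K) p, z • t = -t)
    (hIs : (W.baseChange K).HasIrreducibleModPGaloisRep p)
    (hIc : ∀ f : geomTorsion (W.baseChange K) p →+ geomTorsion (W.baseChange K) p,
      (∀ (g : Field.absoluteGaloisGroup K) (t : geomTorsion (W.baseChange K) p), f (g • t) = g • f t) →
        ∃ k : ℤ, ∀ t, f t = k • t)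
    (hIt : AddSubgroup.torsionBy (W.baseChange K).toAffine.Point (p : ℤ) = ⊥) {M₀ : ℕ} (hM₀ : 1 ≤ M₀) [NeZero (p ^ M₀)]
    {c : K ≃ₐ[ℚ] K} (hc : c ≠ 1) (hcc : c * c = 1)
    {x₀ : (W.baseChange K).toAffine.Point} (hx₀ : p ^ M₀ • x₀ = P)
    (hmax : ∀ Q : (W.baseChange K).toAffine.Point, p ^ (M₀ + 1) • Q ≠ P)
    (hpoints : ∀ {M : ℕ} (_hM : 1 ≤ M)
      (hdiv : ∀ Q : geomPoints (W.baseChange K), ∃ R, ((p ^ M : ℕ) : ℤ) • R = Q)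
      (c : K ≃ₐ[ℚ] K) (_hc : c ≠ 1),
      ∃ (ε : ℤ) (τ : AlgebraicClosure K ≃+* AlgebraicClosure K) (hτ : IsLiftOfAut c τ)
        (A : ℕ → AddSubgroup (geomPoints (W.baseChange K)))
        (hA : ∀ m, KolyvaginCocycle.IsAdmissible (Field.absoluteGaloisGroup K) (A m)
          ((p ^ M : ℕ) : ℤ))
        (Pt : ℕ → geomPoints (W.baseChange K))
        (hPt : ∀ m, Pt m ∈
          KolyvaginCocycle.invPoints (Field.absoluteGaloisGroup K) (A m) ((p ^ M : ℕ) : ℤ)),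
        (ε = 1 ∨ ε = -1) ∧
        IsOfFinAddOrder (Affine.Point.map (W' := W) (c : K →ₐ[ℚ] K) P - ε • P) ∧
        (∀ m, ∀ a ∈ A m, hτ.pointsMap W a ∈ A m) ∧
        Pt 1 = toGeomPoints (W.baseChange K) P ∧
        (∀ m : ℕ, Squarefree m →
          (∀ q ∈ m.primeFactors, IsKolyvaginPrime N₀ W K p q ∧ FrobEqFrobInfty W K (p ^ (M + k)) q) →
          (∃ B ∈ A m, hτ.pointsMap W (Pt m) =
            (ε * (-1) ^ m.primeFactors.card) • Pt m + ((p ^ M : ℕ) : ℤ) • B) ∧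
          (∀ v : HeightOneSpectrum (𝓞 K), (m : 𝓞 K) ∉ v.asIdeal →
            kolyvaginClass (W.baseChange K) _ hdiv (hA m) (Pt m) (hPt m) ∈
              selmerLocalKer (W.baseChange K) (v.adicCompletion K) ((p ^ M : ℕ) : ℤ)) ∧
          (∀ ℓ : ℕ, ℓ.Prime → ℓ ∣ m → ∀ v : HeightOneSpectrum (𝓞 K), (ℓ : 𝓞 K) ∈ v.asIdeal →
            ∀ a : ℕ, (((p : ℤ) ^ a) •
                kolyvaginClass (W.baseChange K) _ hdiv (hA m) (Pt m) (hPt m) ∈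
                selmerLocalKer (W.baseChange K) (v.adicCompletion K) ((p ^ M : ℕ) : ℤ) ↔
              ((p : ℤ) ^ a) • kolyvaginClass (W.baseChange K) _ hdiv (hA (m / ℓ)) (Pt (m / ℓ))
                  (hPt (m / ℓ)) ∈
                (W.baseChange K).torsionLocalKer (v.adicCompletion K) ((p ^ M : ℕ) : ℤ)))))
    (hRT : ∀ {M : ℕ} (_hM : 1 ≤ M) {ℓ : ℕ} (hℓ : IsKolyvaginPrime N₀ W K p ℓ),
      FrobEqFrobInfty W K (p ^ M) ℓ →
      ∃ (A : Type) (_ : AddCommGroup A)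
        (e : geomTorsion (W.baseChange K) ((p ^ M : ℕ) : ℤ) →+
          geomTorsion (W.baseChange K) ((p ^ M : ℕ) : ℤ) →+ A),
        (∀ x, e x x = 0) ∧ (∀ x, (∀ y, e x y = 0) → x = 0) ∧
        ∀ (T : Finset (HeightOneSpectrum (𝓞 K))),
        ∀ s ∈ selmerGroup (W.baseChange K) ((p ^ M : ℕ) : ℤ),
          (∀ v ∈ T, s ∈ (W.baseChange K).torsionLocalKer (v.adicCompletion K) ((p ^ M : ℕ) : ℤ)) →
          ∀ c' : galH1Torsion (W.baseChange K) ((p ^ M : ℕ) : ℤ),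
          (∀ v : HeightOneSpectrum (𝓞 K), v ∉ T → (ℓ : 𝓞 K) ∉ v.asIdeal →
            c' ∈ selmerLocalKer (W.baseChange K) (v.adicCompletion K) ((p ^ M : ℕ) : ℤ)) →
          (∀ w : InfinitePlace K,
            c' ∈ selmerLocalKer (W.baseChange K) w.Completion ((p ^ M : ℕ) : ℤ)) →
          ∀ 𝔔 ∈ hℓ.place.primesAbove, ∀ F : Field.absoluteGaloisGroup K,
            IsArithFrobAt (𝓞 K) F 𝔔 →
            F ∈ torsionFixing (W.baseChange K) ((p ^ M : ℕ) : ℤ) →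
            ∀ σ ∈ 𝔔.inertia (Field.absoluteGaloisGroup K),
            e (h1Eval (W.baseChange K) ((p ^ M : ℕ) : ℤ) s F)
              (h1Eval (W.baseChange K) ((p ^ M : ℕ) : ℤ) c' σ) = 0)
    (e : geomTorsion (W.baseChange K) ((p ^ M₀ * p ^ M₀ : ℕ) : ℤ) →
      geomTorsion (W.baseChange K) ((p ^ M₀ * p ^ M₀ : ℕ) : ℤ) → AlgebraicClosure K)
    (hμ : ∀ S T, e S T ^ (p ^ M₀ * p ^ M₀) = 1)
    (hadd₁ : ∀ S₁ S₂ T, e (S₁ + S₂) T = e S₁ T * e S₂ T)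
    (hadd₂ : ∀ S T₁ T₂, e S (T₁ + T₂) = e S T₁ * e S T₂)
    (hgal : ∀ (σ : absoluteGaloisGroup K) (S T : geomTorsion (W.baseChange K) ((p ^ M₀ * p ^ M₀ : ℕ) : ℤ)),
      σ • e S T = e (σ • S) (σ • T))
    (halt : ∀ T, e T T = 1) (hnondeg : ∀ T, (∀ S, e S T = 1) → T = 0)
    (inv : LocalInvariants K (p ^ M₀ * p ^ M₀)) (hPT' : inv.SumInvLocalizationEqZero)
    (hinv : ∀ v : HeightOneSpectrum (𝓞 K), Injective (inv (Sum.inr v)))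
    (hH3 : ∀ x : galoisCohomology (mu K (p ^ M₀ * p ^ M₀)) 3,
      (∀ v : Place K, galoisCohomology.localization (mu K (p ^ M₀ * p ^ M₀)) v 3 x = 0) → x = 0)
    (hB : Literature.GroupTheory.FiniteAbelian.IsLevelPairing (p ^ M₀)
      (ctLevelPairing (W.baseChange K) (p ^ M₀) e hμ hadd₁ hadd₂ hgal inv halt hPT' hH3
        (localTerm_finite_support (W := W.baseChange K) (m := p ^ M₀) (e := e) (hμ := hμ)
          (hadd₁ := hadd₁) (hadd₂ := hadd₂) (hgal := hgal) halt inv)))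
    (hPτ : ∀ z ∈ selmerGroup (W.baseChange K) ((p ^ M₀ * p ^ M₀ : ℕ) : ℤ),
      ∀ t ∈ selmerGroup (W.baseChange K) ((p ^ M₀ * p ^ M₀ : ℕ) : ℤ),
      ctGeneralFun (W.baseChange K) (p ^ M₀) e hμ hadd₁ hadd₂ hgal inv
          (torsionH1ToH1 (W.baseChange K) _ (conjAct W c _ z))
          (torsionH1ToH1 (W.baseChange K) _ (conjAct W c _ t)) =
        ctGeneralFun (W.baseChange K) (p ^ M₀) e hμ hadd₁ hadd₂ hgal inv
          (torsionH1ToH1 (W.baseChange K) _ z) (torsionH1ToH1 (W.baseChange K) _ t)) :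
    Finite (AddCommGroup.primaryComponent (W.baseChange K).sha p) ∧
    (∀ c ∈ AddCommGroup.primaryComponent (W.baseChange K).sha p, p ^ M₀ • c = 0) ∧
    Nat.card (AddCommGroup.primaryComponent (W.baseChange K).sha p) ≤ p ^ (2 * M₀) ∧
    padicValNat p (Nat.card (AddCommGroup.primaryComponent (W.baseChange K).sha p)) ≤ 2 * M₀ := by
  refine card_sha_primary_le_at_of_leavesM₂_of_localDuality_shift_ofImage W hK hN k hnt hp hp2 hIz hIs hIc hIt
    Literature.NumberTheory.Automorphic.chebotarev_artinRep_holds (W.exists_weilPairing_holds p) hM₀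
    hc hcc hx₀ hmax ?_ e hμ hadd₁ hadd₂ hgal halt hnondeg inv hPT' hinv hH3 hB hPτ
  intro M hM hdiv c₁ hc₁
  obtain ⟨ε, τ, hτ, A, hA, Pt, hPt, hε, h53, hAτ, hPt1, hm'⟩ := hpoints hM hdiv c₁ hc₁
  obtain ⟨cl, hc1, hcl⟩ := exists_leafA_of_points_shift (N := N₀) k hdiv c₁ hτ ε A hA hAτ Pt hPt hPt1
    (fun m hm'' hk ↦ (hm' m hm'' hk).1) (fun m hm'' hk ↦ (hm' m hm'' hk).2.1)
    (fun m hm'' hk ↦ (hm' m hm'' hk).2.2)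
  have hMk : M ≤ M + k := Nat.le_add_right M k
  refine ⟨ε, cl, hε, h53, hc1, hcl, fun ℓ hℓ ↦ ?_, fun ℓ ℓ' hℓ hℓ' ↦ ?_⟩
  · exact hdual_of_kolyvaginReciprocityFinset_of_conductorNorm W hN hK hp hp2 hM hc₁
      (fun hℓ hℓM ↦ hRT hM hℓ hℓM) ℓ ⟨hℓ.1, frobEqFrobInfty_pow_of_le W K hMk hℓ.2⟩
  · exact hdual₂_of_kolyvaginReciprocityFinset_of_conductorNorm W hN hK hp hp2 hM hc₁
      (fun hℓ hℓM ↦ hRT hM hℓ hℓM) ℓ ℓ' ⟨hℓ.1, frobEqFrobInfty_pow_of_le W K hMk hℓ.2⟩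
      ⟨hℓ'.1, frobEqFrobInfty_pow_of_le W K hMk hℓ'.2⟩

section PartTwo

open scoped Classical AddSubgroup

open Summit.BirchSwinnertonDyer.BirchSwinnertonDyer.Theorems.ShimuraKolyvaginLocalShift
open WeierstrassCurve NumberField IsDedekindDomain Field Function
  Literature.NumberTheory.EllipticCurves Literature.NumberTheory.EllipticCurves.KolyvaginCocycle
  Literature.NumberTheory.EllipticCurves.KolyvaginDescent
  Literature.NumberTheory.EllipticCurves.RingClassField
  Literature.NumberTheory.GaloisRepresentations Literature.NumberTheory.GaloisCohomology
  Literature.NumberTheory.NumberFields Literature.NumberTheory.DiophantineGeometry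
  Summit.BirchSwinnertonDyer.Rank1Residual.X11b
  Summit.BirchSwinnertonDyer.BirchSwinnertonDyer.Theorems
  Summit.BirchSwinnertonDyer.BirchSwinnertonDyer.Theorems.ShimuraKolyvaginOrder
open Literature.NumberTheory.GaloisRepresentations.DiscreteGaloisModule (mu MuCarrier)

-- Cup products need `LocallyCompactSpace Γ_K`; as in the tree's Cassels–Tate files.
attribute [local instance] absoluteGaloisGroup_compactSpace

-- `CharZero` of the completions (the Cassels–Tate local terms), as in the tree's files.
attribute [local instance] charZero_placeCompletion

variable {K : Type} [Field K] [NumberField K]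

/-- **McCallum 1991 §1 Theorem (Kolyvagin), ORDER form, for ANY odd prime `p` with `ρ̄_{E,p}` onto, for a Heegner-type
Euler system rational over the ring class fields read one notch deeper, from Poitou–Tate and the Cassels–Tate inputs —
NO Kodaira–Néron ∕ Tamagawa clause** (module docstring). For `p^{M₀} x₀ = P ∉ p^{M₀+1}E(K)`, `M₀ ≥ 1`: `Ш(E/K)[p^∞]`
finite, killed by `p^{M₀}`, of order `≤ p^{2M₀}`, `ord_p ≤ 2M₀`. Proof: the depth-`k₀` ORDER entry
`card_sha_primary_le_at_of_pointsM_of_reciprocityFinset_of_localDuality_shift_ofImage` (`k₀ = 1 + Σ_{ℓ ∣ N} v_p(ord_ℓ Δ_min(E/ℚ))`,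
shim-p1's `padicValNat_ordMinimalDiscriminant_le_of_split`) with clause (d) from the shift leaf
`kolyvaginClass_mem_selmerLocalKer_of_ringClassRational_shift` and `hRT` from
`kolyvaginReciprocityFinset_of_poitouTate_of_conductorNorm`. [cite: McCallumLMS1991, §1 Theorem (Kolyvagin), Lemma 4.6, Cor. 5.6]
[cite: GrossLMS1991, §2 Thm. 2.2 (2)] [cite: Howard2004Duke, Thm. 3.2.2 (proof)] [cite: MilneADT2006, Ch. I Thm. 4.10(b), §6 Thm. 6.13(a)] -/
theorem card_sha_primary_le_of_ringClassRationalPointsM_shift_of_poitouTate_of_localDuality_ofImage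
    (hPT : poitouTate_sum_localTatePairing_eq_zero K)
    (W : WeierstrassCurve ℚ) [W.IsElliptic] [W.IsGloballyMinimal] {N : ℕ} [NeZero N]
    (hN : W.conductorNorm ℤ = N) {p : ℕ} (hp : p.Prime) (hp2 : p ≠ 2) (hIz : ∃ z : Field.absoluteGaloisGroup K, ∀ t : geomTorsion (W.baseChange K) p, z • t = -t)
    (hIs : (W.baseChange K).HasIrreducibleModPGaloisRep p)
    (hIc : ∀ f : geomTorsion (W.baseChange K) p →+ geomTorsion (W.baseChange K) p,
      (∀ (g : Field.absoluteGaloisGroup K) (t : geomTorsion (W.baseChange K) p), f (g • t) = g • f t) →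
        ∃ k : ℤ, ∀ t, f t = k • t)
    (hIt : AddSubgroup.torsionBy (W.baseChange K).toAffine.Point (p : ℤ) = ⊥)
    (hK : IsImaginaryQuadratic K) (ι : K →+* ℂ) {S : Finset ℕ}
    (hin : ∀ ℓ ∈ S, ℓ.Prime ∧ ℓ ∣ N ∧ ¬ ℓ ^ 2 ∣ N ∧
      ((Ideal.span {(ℓ : ℤ)}).primesOver (𝓞 K)).ncard = 1 ∧ ¬ (ℓ : ℤ) ∣ NumberField.discr K)
    (hsp : ∀ ℓ : ℕ, ℓ.Prime → ℓ ∣ N → ℓ ∉ S → ((Ideal.span {(ℓ : ℤ)}).primesOver (𝓞 K)).ncard = 2)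
    {P : (W.baseChange K).toAffine.Point} (hnt : ¬ IsOfFinAddOrder P)
    {M₀ : ℕ} (hM₀ : 1 ≤ M₀) [NeZero (p ^ M₀)] {c : K ≃ₐ[ℚ] K} (hc : c ≠ 1) (hcc : c * c = 1)
    {x₀ : (W.baseChange K).toAffine.Point} (hx₀ : p ^ M₀ • x₀ = P)
    (hmax : ∀ Q : (W.baseChange K).toAffine.Point, p ^ (M₀ + 1) • Q ≠ P)
    (hpointsRk : ∀ (k : ℕ) {M : ℕ} (_hM : 1 ≤ M)
      (hdiv : ∀ Q : geomPoints (W.baseChange K), ∃ R, ((p ^ M : ℕ) : ℤ) • R = Q)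
      (c : K ≃ₐ[ℚ] K) (_hc : c ≠ 1),
      ∃ (ε : ℤ) (τ : AlgebraicClosure K ≃+* AlgebraicClosure K) (hτ : IsLiftOfAut c τ)
        (A : ℕ → AddSubgroup (geomPoints (W.baseChange K)))
        (hA : ∀ m, KolyvaginCocycle.IsAdmissible (Field.absoluteGaloisGroup K) (A m)
          ((p ^ M : ℕ) : ℤ))
        (emb : ∀ m : ℕ, ringClassField K ι m →ₐ[K] AlgebraicClosure K)
        (Pt : ℕ → geomPoints (W.baseChange K))
        (hPt : ∀ m, Pt m ∈
          KolyvaginCocycle.invPoints (Field.absoluteGaloisGroup K) (A m) ((p ^ M : ℕ) : ℤ)),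
        (ε = 1 ∨ ε = -1) ∧
        IsOfFinAddOrder (Affine.Point.map (W' := W) (c : K →ₐ[ℚ] K) P - ε • P) ∧
        (∀ m, ∀ a ∈ A m, hτ.pointsMap W a ∈ A m) ∧
        Pt 1 = toGeomPoints (W.baseChange K) P ∧
        (∀ m, m ≠ 0 → ∀ a ∈ A m, ∀ Φ : Field.absoluteGaloisGroup K,
          (∀ x : ringClassField K ι m, Φ • emb m x = emb m x) → Φ • a = a) ∧
        (∀ m, KolyvaginCocycle.IsAdmissible (Field.absoluteGaloisGroup K) (A m)
          ((p ^ (M + k) : ℕ) : ℤ)) ∧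
        (∀ m : ℕ, Squarefree m →
          (∀ q ∈ m.primeFactors, IsKolyvaginPrime N W K p q ∧ FrobEqFrobInfty W K (p ^ (M + k)) q) →
          Pt m ∈ KolyvaginCocycle.invPoints (Field.absoluteGaloisGroup K) (A m)
            ((p ^ (M + k) : ℕ) : ℤ) ∧
          (∃ B ∈ A m, hτ.pointsMap W (Pt m) =
            (ε * (-1) ^ m.primeFactors.card) • Pt m + ((p ^ M : ℕ) : ℤ) • B) ∧
          (∀ ℓ : ℕ, ℓ.Prime → ℓ ∣ m → ∀ v : HeightOneSpectrum (𝓞 K), (ℓ : 𝓞 K) ∈ v.asIdeal →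
            ∀ a : ℕ, (((p : ℤ) ^ a) •
                kolyvaginClass (W.baseChange K) _ hdiv (hA m) (Pt m) (hPt m) ∈
                selmerLocalKer (W.baseChange K) (v.adicCompletion K) ((p ^ M : ℕ) : ℤ) ↔
              ((p : ℤ) ^ a) • kolyvaginClass (W.baseChange K) _ hdiv (hA (m / ℓ)) (Pt (m / ℓ))
                  (hPt (m / ℓ)) ∈
                (W.baseChange K).torsionLocalKer (v.adicCompletion K) ((p ^ M : ℕ) : ℤ)))))
    (e : geomTorsion (W.baseChange K) ((p ^ M₀ * p ^ M₀ : ℕ) : ℤ) →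
      geomTorsion (W.baseChange K) ((p ^ M₀ * p ^ M₀ : ℕ) : ℤ) → AlgebraicClosure K)
    (hμ : ∀ S T, e S T ^ (p ^ M₀ * p ^ M₀) = 1)
    (hadd₁ : ∀ S₁ S₂ T, e (S₁ + S₂) T = e S₁ T * e S₂ T)
    (hadd₂ : ∀ S T₁ T₂, e S (T₁ + T₂) = e S T₁ * e S T₂)
    (hgal : ∀ (σ : absoluteGaloisGroup K) (S T : geomTorsion (W.baseChange K) ((p ^ M₀ * p ^ M₀ : ℕ) : ℤ)),
      σ • e S T = e (σ • S) (σ • T))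
    (halt : ∀ T, e T T = 1) (hnondeg : ∀ T, (∀ S, e S T = 1) → T = 0)
    (inv : LocalInvariants K (p ^ M₀ * p ^ M₀)) (hPT' : inv.SumInvLocalizationEqZero)
    (hinv : ∀ v : HeightOneSpectrum (𝓞 K), Injective (inv (Sum.inr v)))
    (hH3 : ∀ x : galoisCohomology (mu K (p ^ M₀ * p ^ M₀)) 3,
      (∀ v : Place K, galoisCohomology.localization (mu K (p ^ M₀ * p ^ M₀)) v 3 x = 0) → x = 0)
    (hB : Literature.GroupTheory.FiniteAbelian.IsLevelPairing (p ^ M₀)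
      (ctLevelPairing (W.baseChange K) (p ^ M₀) e hμ hadd₁ hadd₂ hgal inv halt hPT' hH3
        (localTerm_finite_support (W := W.baseChange K) (m := p ^ M₀) (e := e) (hμ := hμ)
          (hadd₁ := hadd₁) (hadd₂ := hadd₂) (hgal := hgal) halt inv)))
    (hPτ : ∀ z ∈ selmerGroup (W.baseChange K) ((p ^ M₀ * p ^ M₀ : ℕ) : ℤ),
      ∀ t ∈ selmerGroup (W.baseChange K) ((p ^ M₀ * p ^ M₀ : ℕ) : ℤ),
      ctGeneralFun (W.baseChange K) (p ^ M₀) e hμ hadd₁ hadd₂ hgal inv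
          (torsionH1ToH1 (W.baseChange K) _ (conjAct W c _ z))
          (torsionH1ToH1 (W.baseChange K) _ (conjAct W c _ t)) =
        ctGeneralFun (W.baseChange K) (p ^ M₀) e hμ hadd₁ hadd₂ hgal inv
          (torsionH1ToH1 (W.baseChange K) _ z) (torsionH1ToH1 (W.baseChange K) _ t)) :
    Finite (AddCommGroup.primaryComponent (W.baseChange K).sha p) ∧
    (∀ c ∈ AddCommGroup.primaryComponent (W.baseChange K).sha p, p ^ M₀ • c = 0) ∧
    Nat.card (AddCommGroup.primaryComponent (W.baseChange K).sha p) ≤ p ^ (2 * M₀) ∧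
    padicValNat p (Nat.card (AddCommGroup.primaryComponent (W.baseChange K).sha p)) ≤ 2 * M₀ := by
  haveI : (W.baseChange K).IsElliptic := inferInstanceAs (W.map (algebraMap ℚ K)).IsElliptic
  -- the depth `k₀` absorbing the `p`-parts of all Kodaira–Néron exponents on the locus
  set k₀ : ℕ := 1 + ∑ q ∈ N.primeFactors, padicValNat p (padicValInt q W.minimalDiscriminantInt) with hk₀
  have hk1 : 1 ≤ k₀ := Nat.le_add_right 1 _
  have hkm : ∀ w : HeightOneSpectrum (𝓞 K), (W.baseChange K).HasMultiplicativeReductionAt w →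
      ((Rat.HeightOneSpectrum.primesEquiv (w.under (𝓞 ℚ)) : ℕ)) ∉ S →
      padicValNat p ((W.baseChange K).ordMinimalDiscriminant w) ≤ k₀ := fun w hmw hℓS ↦
    padicValNat_ordMinimalDiscriminant_le_of_split hK W hN p hsp w hmw hℓS
  refine card_sha_primary_le_at_of_pointsM_of_reciprocityFinset_of_localDuality_shift_ofImage W hK hN k₀ hnt hp hp2 hIz hIs hIc hIt hM₀
    hc hcc hx₀ hmax ?_
    (@fun _ hM _ hℓ _ ↦ kolyvaginReciprocityFinset_of_poitouTate_of_conductorNorm W hN hPT hp hM hℓ)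
    e hμ hadd₁ hadd₂ hgal halt hnondeg inv hPT' hinv hH3 hB hPτ
  intro M hM hdiv c₁ hc₁
  obtain ⟨ε, τ, hτ, A, hA, emb, Pt, hPt, hε, h53, hAτ, hPt1, hrat, hAk, hm'⟩ := hpointsRk k₀ hM hdiv c₁ hc₁
  refine ⟨ε, τ, hτ, A, hA, Pt, hPt, hε, h53, hAτ, hPt1, fun m hm hk ↦
    ⟨(hm' m hm hk).2.1, ?_, (hm' m hm hk).2.2⟩⟩
  intro v hv
  have hm0 : m ≠ 0 := Squarefree.ne_zero hm
  exact kolyvaginClass_mem_selmerLocalKer_of_ringClassRational_shift hK ι hm0 (emb m) W hp hp2 hin hk1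
    hkm (fun q hq ↦ (hk q hq).1.2.1) (hA m) (hAk m) (hrat m hm0) (hPt m) ((hm' m hm hk).1) v hv

end PartTwo

end Summit.BirchSwinnertonDyer.BirchSwinnertonDyer.Theorems.ShimuraKolyvaginOfImage

end
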